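import Literature.NumberTheory.Automorphic.TorusCharacterLocalComponents
import Literature.NumberTheory.GaloisRepresentations.HeckeCharacterWeakApproximation
import HarnessLib

/-!
# Rigidity of automorphic characters of the norm-one torus `T = U(1)_{K/F₀}` from the SPLIT places
# (weak approximation for the rational one-dimensional torus; Cassels–Fröhlich Ch. II §6, Ch. VII §4; Hilbert 90)

Topic `NumberTheory/Automorphic`; namespace `Literature.NumberTheory.Automorphic.UnitaryGroup`.  PROOF FILE: theorems only (no
definition, no named fact, no instance, no notation, no `sorry`).  Setting of ★ `Arthur2013/Leaves/TorusDictionary` (§45) and ★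
`TorusCharacterLocalComponents`: a quadratic extension of number fields `K/F₀` with non-trivial automorphism `c` (`h2 : [K : F₀] = 2`,
`hc : c ≠ 1`), the adelic norm-one torus `T(𝔸_{F₀}) = TorusDict.torus c ≤ 𝕀_K`, automorphic characters
`ψ : T(𝔸_{F₀}) →ₜ* ℂˣ` (`TorusDict.IsAutomorphic`) and their base change
`χ̃ = TorusDict.pullback ψ = ψ ∘ (z ↦ c • z / z)`, a Hecke character of `K`.

THE THEOREM.  **An automorphic character of `T(𝔸_{F₀})` is determined by its local components at the finite places of `F₀` that
SPLIT in `K`**: if `χ̃_w = χ̃′_w` for every finite place `w` of `K` MOVED by `c` (`c • w ≠ w`, i.e. `w` lies over a split place),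
then `ψ = ψ′` (`torusCharacter_eq_of_split`; one place in each pair `{w, c • w}` suffices, `torusCharacter_eq_of_split'`; the
torus-local currency `ξ_v = torusLocalComponent v ψ` of ★ `TorusCharacterLocalComponents`:
`torusCharacter_eq_of_torusLocalComponent_eq_of_split`).  NO hypothesis at the non-split or at the archimedean places.

WHY THIS IS ALGEBRAIC (no `L`-functions, no Chebotarev).  For a Hecke character of `GL₁/K`, agreement on a set of places with
infinite complement is an analytic statement; for the ANISOTROPIC torus `T` it is weak approximation: at a finite place of `F₀`
that does not split the local torus `K_w^1` is compact — every norm-one element is a UNIT (★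
`TorusDict.valuation_eq_one_of_mem_torus`).  Proof of `torusCharacter_eq_one_of_split` (Tate's density argument, Cassels–Fröhlich
Ch. VII §4 Prop. 4.1 «`k^* J_k^S` is dense in `J_k`», here ★ `HeckeCharacter.eq_one_of_forall_localUnits`, run for the torus): for
an idele `z` choose `a ∈ K^×` close to `z` at the finitely many places named by a neighbourhood of `1` and at the archimedean places
(★ `denseRange_algebraMap_pi_prod`); the twist `c • y / y` of `y = z a⁻¹` is then close to `1` there, integral at every other
non-split place, and its components at the finitely many offending SPLIT places are peeled off by the hypothesis `χ̃ ∘ localUnits w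
= 1` (`c • w ≠ w`); the rest lies in the neighbourhood (★ `ideleGroup_exists_nhds_congruenceSubgroup_subset`).  So `χ̃ z` is in
every neighbourhood of `1`, `χ̃ = 1`, and `ψ = 1` as the twist `𝕀_K → T(𝔸)` is onto (idelic Hilbert 90, ★
`TorusDict.twistToTorus_surjective`).  Equivalently: the rational curve `T ≅ {x² − d y² = 1}` has weak approximation
(Platonov–Rapinchuk §7.3 Prop. 7.8), so `T(F₀) · ∏'_{v split} T(F₀,v)` is dense in `T(𝔸_{F₀})`.

USE (Hodge-CM programme, floor 0, row III-J3a): `ξ = (η, ψ)` ∈ ★ `Rogawski1990.OneDimAutRepH` is a pair of automorphic characters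
of `T`, and a ξ-local family (★ `Rogawski1990.MemXiFamily`) pins at every SPLIT place the local components of the base changes
`η̃, ψ̃`; this file is the global half of «a ξ-local family determines `ξ`» (family rigidity U♭), with no appeal to the
non-split packets.

## References
* J. W. S. Cassels, A. Fröhlich (eds.), *Algebraic Number Theory* (1967): Ch. II (Cassels) §6 (weak approximation), Ch. VII (Tate)
  §4 Prop. 4.1 and its proof, Ch. V §2.7 (Hilbert 90) [CasselsFrohlichANT1967].
* V. Platonov, A. Rapinchuk, *Algebraic Groups and Number Theory* (1994), §7.3 Prop. 7.8 [PlatonovRapinchuk1994].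
* J. Rogawski, *Automorphic Representations of Unitary Groups in Three Variables* (1990), §13.1 p. 199 [Rogawski1990].
-/

set_option autoImplicit false

noncomputable section

open NumberField IsDedekindDomain
open Literature.NumberTheory.GaloisRepresentations
open Literature.NumberTheory.Automorphic.Arthur2013.Leaves.TECR
open scoped Topology

namespace Literature.NumberTheory.Automorphic

namespace UnitaryGroup

variable {F₀ K : Type} [Field F₀] [NumberField F₀] [Field K] [NumberField K] [Algebra F₀ K]
  (c : K ≃ₐ[F₀] K) (h2 : Module.finrank F₀ K = 2) (hc : c ≠ 1)

/-! ## §0 The Galois involution on the places of `K` (`c⁻¹ = c`, ★ `HeckeCharacter.CMQuadraticExtension.inv_eq_self`) -/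

include h2 hc in
/-- `c • c • w = w` on the finite places of `K`. [cite: CasselsFrohlichANT1967, Ch. VII §1.1] -/
theorem smul_smul_place (w : HeightOneSpectrum (𝓞 K)) : c • c • w = w := by
  rw [smul_smul, HeckeCharacter.CMQuadraticExtension.mul_self_eq_one c h2 hc, one_smul]

include h2 hc in
/-- `c⁻¹ • w = c • w` on the finite places of `K`. [cite: CasselsFrohlichANT1967, Ch. VII §1.1] -/
theorem inv_smul_place (w : HeightOneSpectrum (𝓞 K)) : c⁻¹ • w = c • w := by
  rw [HeckeCharacter.CMQuadraticExtension.inv_eq_self c h2 hc]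

/-! ## §1 An automorphic character of `T(𝔸_{F₀})` trivial at the split places is trivial -/

omit [NumberField F₀] in
/-- **Finite components of the twist `c • y / y` at a place MOVED by `c`**: `(c • y / y)_w = c_*(y_{c⁻¹ w}) · y_w⁻¹`.
[cite: CasselsFrohlichANT1967, Ch. VII §1.1] -/
theorem twist_snd_apply (y : ideleGroup K) (w : HeightOneSpectrum (𝓞 K)) :
    ((Herbrand.twist c y : ideleGroup K) : AdeleRing (𝓞 K) K).2 w =
      galAdicCompletionMap c (smul_inv_smul c w) ((y : AdeleRing (𝓞 K) K).2 (c⁻¹ • w)) *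
        ((y : AdeleRing (𝓞 K) K).2 w)⁻¹ := by
  rw [Herbrand.twist_apply, div_eq_mul_inv, ideleGroup_val_snd_mul, IdeleHerbrand.snd_smul_apply,
    ideleGroup_val_inv_snd]

omit [NumberField F₀] in
/-- **Finite components of the twist at a place FIXED by `c`**: `(c • y / y)_w = c_w(y_w) · y_w⁻¹` with `c_w` the
Galois involution of `K_w`. [cite: CasselsFrohlichANT1967, Ch. VII §1.1] -/
theorem twist_snd_apply_of_smul_eq (y : ideleGroup K) {w : HeightOneSpectrum (𝓞 K)} (hw : c • w = w) :
    ((Herbrand.twist c y : ideleGroup K) : AdeleRing (𝓞 K) K).2 w =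
      galAdicCompletionMap c hw ((y : AdeleRing (𝓞 K) K).2 w) * ((y : AdeleRing (𝓞 K) K).2 w)⁻¹ := by
  have hw' : c⁻¹ • w = w := by rw [inv_smul_eq_iff, hw]
  rw [twist_snd_apply, galAdicCompletionMap_apply_congr_place K hw' (smul_inv_smul c w) hw
    (fun u => (y : AdeleRing (𝓞 K) K).2 u)]

omit [NumberField F₀] in
/-- Archimedean part of the twist: `(c • y / y)_∞ = c • y_∞ · (y⁻¹)_∞`. [cite: CasselsFrohlichANT1967, Ch. VII §1.1] -/
theorem twist_fst (y : ideleGroup K) :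
    ((Herbrand.twist c y : ideleGroup K) : AdeleRing (𝓞 K) K).1 =
      c • (y : AdeleRing (𝓞 K) K).1 * ((y⁻¹ : ideleGroup K) : AdeleRing (𝓞 K) K).1 := by
  rw [Herbrand.twist_apply, div_eq_mul_inv, ideleGroup_val_fst_mul, IdeleHerbrand.fst_smul]

omit [NumberField F₀] in
/-- Archimedean part of the inverse twist: `((c • y / y)⁻¹)_∞ = y_∞ · c • (y⁻¹)_∞`.
[cite: CasselsFrohlichANT1967, Ch. VII §1.1] -/
theorem twist_inv_fst (y : ideleGroup K) :
    (((Herbrand.twist c y)⁻¹ : ideleGroup K) : AdeleRing (𝓞 K) K).1 =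
      (y : AdeleRing (𝓞 K) K).1 * c • ((y⁻¹ : ideleGroup K) : AdeleRing (𝓞 K) K).1 := by
  rw [Herbrand.twist_apply, inv_div, div_eq_mul_inv, ← smul_inv', ideleGroup_val_fst_mul, IdeleHerbrand.fst_smul]

omit [NumberField F₀] in
/-- **The local estimate at a fixed place**: if `|b − 1|_w < q_w^{-(m+1)}` then `|c_w(b) b⁻¹ − 1|_w ≤ q_w^{-m}` (`c_w` is an
isometry fixing `1`). [cite: CasselsFrohlichANT1967, Ch. VII §1.1] -/
theorem valued_gal_mul_inv_sub_one_le {w : HeightOneSpectrum (𝓞 K)} (hw : c • w = w) (b : w.adicCompletion K) (m : ℕ)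
    (hb : Valued.v (b - 1) < WithZero.exp (-((m + 1 : ℕ) : ℤ))) :
    Valued.v (galAdicCompletionMap c hw b * b⁻¹ - 1) ≤ WithZero.exp (-(m : ℤ)) := by
  have hb1 : Valued.v (b - 1) < Valued.v (1 : w.adicCompletion K) := by
    rw [map_one, ← WithZero.exp_zero]
    exact hb.trans_le (WithZero.exp_le_exp.2 (by push_cast; omega))
  have hvb : Valued.v b = 1 := by rw [Valuation.map_eq_of_sub_lt _ hb1, map_one]
  have hb0 : b ≠ 0 := fun h => by rw [h, map_zero] at hvb; exact zero_ne_one hvb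
  have hσ : Valued.v (galAdicCompletionMap c hw b - 1) = Valued.v (b - 1) := by
    rw [show galAdicCompletionMap c hw b - 1 = galAdicCompletionMap c hw (b - 1) by rw [map_sub, map_one],
      valued_galAdicCompletionMap]
  have hdiff : Valued.v (galAdicCompletionMap c hw b - b) ≤ Valued.v (b - 1) := by
    have h := Valuation.map_sub (Valued.v : Valuation (w.adicCompletion K) _) (galAdicCompletionMap c hw b - 1) (b - 1)
    rw [sub_sub_sub_cancel_right, hσ, max_self] at h
    exact h
  calc Valued.v (galAdicCompletionMap c hw b * b⁻¹ - 1)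
      = Valued.v ((galAdicCompletionMap c hw b - b) * b⁻¹) := by rw [sub_mul, mul_inv_cancel₀ hb0]
    _ = Valued.v (galAdicCompletionMap c hw b - b) := by rw [map_mul, map_inv₀, hvb, inv_one, mul_one]
    _ ≤ Valued.v (b - 1) := hdiff
    _ ≤ WithZero.exp (-(m : ℤ)) := hb.le.trans (WithZero.exp_le_exp.2 (by push_cast; omega))

/-- **An automorphic character of `T(𝔸_{F₀})` whose base change is trivial on `K_wˣ` for every `c`-MOVED finite place
`w` of `K` (i.e. at the places over the SPLIT places of `F₀`) is trivial.**  Weak approximation for the rational torus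
`T = U(1)_{K/F₀}`: see the module docstring for the proof (Tate's density argument, with the compactness of the local
torus at the non-split places in place of a finite exceptional set).
[cite: CasselsFrohlichANT1967, Ch. VII §4 Prop. 4.1 (proof); Ch. II §6] [cite: PlatonovRapinchuk1994, §7.3 Prop. 7.8] -/
theorem torusCharacter_eq_one_of_split (ψ : ↥(TorusDict.torus c) →ₜ* ℂˣ) (hψ : TorusDict.IsAutomorphic c ψ)
    (h : ∀ w : HeightOneSpectrum (𝓞 K), c • w ≠ w →
      ∀ a : (w.adicCompletion K)ˣ, TorusDict.pullback c h2 hc ψ hψ (localUnits w a) = 1) :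
    ψ = 1 := by
  classical
  -- it suffices to kill the base change `χ = ψ ∘ twist` on all of `𝕀_K` (the twist is onto, idelic Hilbert 90)
  suffices hz : ∀ z : ideleGroup K, TorusDict.pullback c h2 hc ψ hψ z = 1 by
    refine ContinuousMonoidHom.ext fun t => ?_
    obtain ⟨z, rfl⟩ := TorusDict.twistToTorus_surjective c h2 hc t
    rw [← TorusDict.pullback_apply c h2 hc ψ hψ, hz z]
    rfl
  intro z
  set χ : HeckeCharacter K := TorusDict.pullback c h2 hc ψ hψ with hχdef
  suffices hmain : ∀ W ∈ 𝓝 (1 : ℂˣ), χ z ∈ W by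
    by_contra hx
    exact hmain {w | w ≠ χ z} (isOpen_ne.mem_nhds (Ne.symm hx)) rfl
  intro W hW
  -- a neighbourhood of `1` in the torus on which `ψ ∈ W`, lifted to `𝕀_K`
  have hN : ψ ⁻¹' W ∈ 𝓝 (1 : ↥(TorusDict.torus c)) :=
    (map_continuous ψ).continuousAt.preimage_mem_nhds (by rwa [map_one])
  obtain ⟨H, hH, hHN⟩ := (mem_nhds_subtype _ (1 : ↥(TorusDict.torus c)) _).1 hN
  have hH1 : H ∈ 𝓝 (1 : ideleGroup K) := by simpa only [OneMemClass.coe_one] using hH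
  obtain ⟨U₁, hU₁, T, hT, e, hTe⟩ := ideleGroup_exists_nhds_congruenceSubgroup_subset hH1
  have hkey : ∀ y : ideleGroup K, Herbrand.twist c y ∈ H → χ y ∈ W := fun y hy =>
    hHN (show TorusDict.twistToTorus c h2 hc y ∈ Subtype.val ⁻¹' H from hy)
  set xinf : InfiniteAdeleRing K := (z : AdeleRing (𝓞 K) K).1 with hxinf
  set xiinf : InfiniteAdeleRing K := ((z⁻¹ : ideleGroup K) : AdeleRing (𝓞 K) K).1 with hxiinf
  have hinv : ∀ (y : ideleGroup K) (w : InfinitePlace K),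
      ((y⁻¹ : ideleGroup K) : AdeleRing (𝓞 K) K).1 w = ((y : AdeleRing (𝓞 K) K).1 w)⁻¹ := by
    intro y w
    have hm := congrFun (ideleGroup_val_inv_fst_mul y) w
    change ((y⁻¹ : ideleGroup K) : AdeleRing (𝓞 K) K).1 w * (y : AdeleRing (𝓞 K) K).1 w = 1 at hm
    exact eq_inv_of_mul_eq_one_left hm
  have hx0 : ∀ w : InfinitePlace K, xinf w ≠ 0 := by
    intro w
    have hm := congrFun (ideleGroup_val_inv_fst_mul z) w
    change xiinf w * xinf w = 1 at hm
    exact right_ne_zero_of_mul_eq_one hm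
  have hxi : ∀ w : InfinitePlace K, xiinf w = (xinf w)⁻¹ := fun w => hinv z w
  have hxf0 : ∀ v : HeightOneSpectrum (𝓞 K), (z : AdeleRing (𝓞 K) K).2 v ≠ 0 := ideleGroup_snd_ne_zero z
  set S : Finset (HeightOneSpectrum (𝓞 K)) := hT.toFinset with hSdef
  -- the space `Y = (∏_{v ∈ S} K_v) × K_∞`, the target point and the test maps
  let y₀ : (∀ v : S, v.1.adicCompletion K) × InfiniteAdeleRing K := (fun v => (z : AdeleRing (𝓞 K) K).2 v.1, xinf)
  let f₁ : (∀ v : S, v.1.adicCompletion K) × InfiniteAdeleRing K → InfiniteAdeleRing K :=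
    fun p => fun w => xinf w * (p.2 w)⁻¹
  let f₂ : (∀ v : S, v.1.adicCompletion K) × InfiniteAdeleRing K → InfiniteAdeleRing K :=
    fun p => fun w => p.2 w * xiinf w
  let F₁ : (∀ v : S, v.1.adicCompletion K) × InfiniteAdeleRing K → InfiniteAdeleRing K :=
    fun p => c • f₁ p * f₂ p
  let F₂ : (∀ v : S, v.1.adicCompletion K) × InfiniteAdeleRing K → InfiniteAdeleRing K :=
    fun p => f₁ p * c • f₂ p
  let g : ∀ v : S, (∀ v : S, v.1.adicCompletion K) × InfiniteAdeleRing K → v.1.adicCompletion K :=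
    fun v p => (z : AdeleRing (𝓞 K) K).2 v.1 * (p.1 v)⁻¹
  have hf₁ : ContinuousAt f₁ y₀ := by
    refine continuousAt_pi.2 fun w => ?_
    have hcw : ContinuousAt (fun p : (∀ v : S, v.1.adicCompletion K) × InfiniteAdeleRing K => p.2 w) y₀ :=
      ((continuous_apply w).comp continuous_snd).continuousAt
    exact continuousAt_const.mul (hcw.inv₀ (hx0 w))
  have hf₂ : ContinuousAt f₂ y₀ := by
    refine continuousAt_pi.2 fun w => ?_
    have hcw : ContinuousAt (fun p : (∀ v : S, v.1.adicCompletion K) × InfiniteAdeleRing K => p.2 w) y₀ :=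
      ((continuous_apply w).comp continuous_snd).continuousAt
    exact hcw.mul continuousAt_const
  have hF₁ : ContinuousAt F₁ y₀ := ((continuous_const_smul c).continuousAt.comp hf₁).mul hf₂
  have hF₂ : ContinuousAt F₂ y₀ := hf₁.mul ((continuous_const_smul c).continuousAt.comp hf₂)
  have hg : ∀ v, ContinuousAt (g v) y₀ := by
    intro v
    have hcv : ContinuousAt (fun p : (∀ v : S, v.1.adicCompletion K) × InfiniteAdeleRing K => p.1 v) y₀ :=
      ((continuous_apply v).comp continuous_fst).continuousAt
    exact continuousAt_const.mul (hcv.inv₀ (hxf0 v.1))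
  have hf₁y : f₁ y₀ = 1 := funext fun w => mul_inv_cancel₀ (hx0 w)
  have hf₂y : f₂ y₀ = 1 := funext fun w => by
    change xinf w * xiinf w = 1
    rw [hxi, mul_inv_cancel₀ (hx0 w)]
  have hF₁y : F₁ y₀ = 1 := by change c • f₁ y₀ * f₂ y₀ = 1; rw [hf₁y, hf₂y, smul_one, mul_one]
  have hF₂y : F₂ y₀ = 1 := by change f₁ y₀ * c • f₂ y₀ = 1; rw [hf₁y, hf₂y, smul_one, mul_one]
  have hgy : ∀ v, g v y₀ = 1 := fun v => mul_inv_cancel₀ (hxf0 v.1)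
  -- congruence balls are neighbourhoods of `1`
  have hB : ∀ (v : HeightOneSpectrum (𝓞 K)) (m : ℕ),
      {b : v.adicCompletion K | Valued.v (b - 1) < WithZero.exp (-(m : ℤ))} ∈ 𝓝 (1 : v.adicCompletion K) := by
    intro v m
    set π : v.adicCompletion K := ((HeckeCharacter.uniformizer K v : (v.adicCompletion K)ˣ) : v.adicCompletion K) ^ m
      with hπdef
    have hπ : Valued.v π = WithZero.exp (-(m : ℤ)) := by
      rw [hπdef, map_pow, HeckeCharacter.valued_uniformizer, ← WithZero.exp_nsmul]
      congr 1
      simp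
    have hopen : IsOpen {b : v.adicCompletion K | Valued.v (b - 1) < Valued.v π} := by
      have h1 : IsOpen {y : v.adicCompletion K | Valued.v y < Valued.v π} := by
        simpa only [Valuation.restrict_lt_iff] using Valued.isOpen_ball (v.adicCompletion K) (Valued.v.restrict π)
      exact h1.preimage (continuous_id.sub continuous_const)
    rw [← hπ]
    refine hopen.mem_nhds ?_
    change Valued.v ((1 : v.adicCompletion K) - 1) < Valued.v π
    rw [sub_self, map_zero, hπ]
    exact zero_lt_iff.2 WithZero.coe_ne_zero
  obtain ⟨w₀⟩ : Nonempty (InfinitePlace K) := inferInstance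
  have hO : {p : (∀ v : S, v.1.adicCompletion K) × InfiniteAdeleRing K | p.2 w₀ ≠ 0} ∈ 𝓝 y₀ :=
    (isOpen_ne_fun ((continuous_apply w₀).comp continuous_snd) continuous_const).mem_nhds (hx0 w₀)
  -- the good neighbourhood of `y₀` and an `a ∈ K` in it
  have h𝒩 : F₁ ⁻¹' U₁ ∩ (F₂ ⁻¹' U₁ ∩ ({p | p.2 w₀ ≠ 0} ∩
      ⋂ v : S, g v ⁻¹' {b | Valued.v (b - 1) < WithZero.exp (-((e v.1 + 1 : ℕ) : ℤ))})) ∈ 𝓝 y₀ := by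
    refine Filter.inter_mem (hF₁.preimage_mem_nhds (by rw [hF₁y]; exact hU₁))
      (Filter.inter_mem (hF₂.preimage_mem_nhds (by rw [hF₂y]; exact hU₁))
        (Filter.inter_mem hO ((Filter.iInter_mem).2 fun v => ?_)))
    exact (hg v).preimage_mem_nhds (by rw [hgy]; exact hB v.1 _)
  obtain ⟨a, ha₁, ha₂, ha₃, ha₄⟩ := (denseRange_algebraMap_pi_prod S).mem_nhds h𝒩
  simp only [Set.mem_iInter, Set.mem_preimage, Set.mem_setOf_eq] at ha₁ ha₂ ha₃ ha₄
  have ha0 : a ≠ 0 := by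
    rintro rfl
    exact ha₃ (by rw [map_zero]; rfl)
  -- `y = z · (a)⁻¹`, its components
  set A : Kˣ := Units.mk0 a ha0 with hA
  have haA : ((A : Kˣ) : K) = a := rfl
  set y : ideleGroup K := z * (GaloisRepresentations.principalIdele K A)⁻¹ with hy
  have hy1 : ∀ w, (y : AdeleRing (𝓞 K) K).1 w = xinf w * (algebraMap K (InfiniteAdeleRing K) a w)⁻¹ := fun w => by
    rw [hy, ideleGroup_val_fst_mul]
    change xinf w * ((((GaloisRepresentations.principalIdele K A)⁻¹ : ideleGroup K) : AdeleRing (𝓞 K) K).1 w) = _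
    rw [hinv, GaloisRepresentations.principalIdele_fst, haA]
  have hy1' : (y : AdeleRing (𝓞 K) K).1 =
      f₁ ((fun v : S => algebraMap K (v.1.adicCompletion K) a), algebraMap K (InfiniteAdeleRing K) a) :=
    funext fun w => hy1 w
  have hyi1 : ∀ w, ((y⁻¹ : ideleGroup K) : AdeleRing (𝓞 K) K).1 w = algebraMap K (InfiniteAdeleRing K) a w * xiinf w :=
    fun w => by rw [hinv, hy1, mul_inv_rev, inv_inv, hxi]
  have hy2 : ∀ v, (y : AdeleRing (𝓞 K) K).2 v = (z : AdeleRing (𝓞 K) K).2 v * (algebraMap K (v.adicCompletion K) a)⁻¹ :=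
    fun v => by
    rw [hy, ideleGroup_val_snd_mul, ideleGroup_val_inv_snd, GaloisRepresentations.principalIdele_snd, haA]
  have hy20 : ∀ v, (y : AdeleRing (𝓞 K) K).2 v ≠ 0 := ideleGroup_snd_ne_zero y
  -- the finitely many `c`-MOVED places to peel off (named by the neighbourhood, or where `y` is not a unit), `c`-stable
  have hT₀ := ideleGroup_valued_snd_eventually_eq_one y
  rw [Filter.eventually_cofinite] at hT₀
  set B : Finset (HeightOneSpectrum (𝓞 K)) := hT₀.toFinset ∪ S with hBdef
  set Q : Finset (HeightOneSpectrum (𝓞 K)) := (B ∪ B.image (fun w => c • w)).filter (fun w => c • w ≠ w) with hQdef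
  have hQmoved : ∀ w ∈ Q, c • w ≠ w := fun w hw => (Finset.mem_filter.1 hw).2
  have hQsmul : ∀ w ∈ Q, c • w ∈ Q := by
    intro w hw
    obtain ⟨hwB, hwm⟩ := Finset.mem_filter.1 hw
    refine Finset.mem_filter.2 ⟨?_, ?_⟩
    · rcases Finset.mem_union.1 hwB with hB | hB
      · exact Finset.mem_union_right _ (Finset.mem_image_of_mem _ hB)
      · obtain ⟨w', hw', rfl⟩ := Finset.mem_image.1 hB
        rw [smul_smul_place c h2 hc]
        exact Finset.mem_union_left _ hw'
    · rw [smul_smul_place c h2 hc]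
      exact fun h' => hwm h'.symm
  have hQinv : ∀ w ∈ Q, c⁻¹ • w ∈ Q := fun w hw => by rw [inv_smul_place c h2 hc]; exact hQsmul w hw
  have hBQ : ∀ w ∈ B, c • w ≠ w → w ∈ Q := fun w hwB hwm =>
    Finset.mem_filter.2 ⟨Finset.mem_union_left _ hwB, hwm⟩
  have hBQ' : ∀ w, c • w ∈ B → c • w ≠ w → w ∈ Q := fun w hwB hwm => by
    refine Finset.mem_filter.2 ⟨Finset.mem_union_right _ ?_, hwm⟩
    refine Finset.mem_image.2 ⟨c • w, hwB, smul_smul_place c h2 hc w⟩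
  have hunitB : ∀ w, w ∉ B → Valued.v ((y : AdeleRing (𝓞 K) K).2 w) = 1 := fun w hw => by
    by_contra hne
    exact hw (Finset.mem_union_left _ (hT₀.mem_toFinset.2 hne))
  -- the peeled idele `y₁` and the peel `y₂`
  let Yu : ∀ w : HeightOneSpectrum (𝓞 K), (w.adicCompletion K)ˣ := fun w => Units.mk0 ((y : AdeleRing (𝓞 K) K).2 w) (hy20 w)
  set y₂ : ideleGroup K := ∏ w ∈ Q, localUnits w (Yu w) with hy₂
  set y₁ : ideleGroup K := y * ∏ w ∈ Q, localUnits w (Yu w)⁻¹ with hy₁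
  have hyy : y = y₁ * y₂ := by
    rw [hy₁, hy₂, mul_assoc, ← Finset.prod_mul_distrib]
    rw [Finset.prod_eq_one fun w _ => by rw [← map_mul, inv_mul_cancel, map_one], mul_one]
  have hχy₂ : χ y₂ = 1 := by
    rw [hy₂, map_prod]
    exact Finset.prod_eq_one fun w hw => h w (hQmoved w hw) (Yu w)
  have hy₁1 : (y₁ : AdeleRing (𝓞 K) K).1 = (y : AdeleRing (𝓞 K) K).1 := by
    rw [hy₁, ideleGroup_val_fst_mul, fst_prod_localUnits, mul_one]
  have hy₁i1 : ((y₁⁻¹ : ideleGroup K) : AdeleRing (𝓞 K) K).1 = ((y⁻¹ : ideleGroup K) : AdeleRing (𝓞 K) K).1 := by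
    funext w
    rw [hinv, hinv, hy₁1]
  have hy₁2 : ∀ w, (y₁ : AdeleRing (𝓞 K) K).2 w = if w ∈ Q then 1 else (y : AdeleRing (𝓞 K) K).2 w := fun w => by
    rw [hy₁, ideleGroup_val_snd_mul, snd_prod_localUnits]
    split_ifs with hw
    · rw [Units.val_inv_eq_inv_val, Units.val_mk0, mul_inv_cancel₀ (hy20 w)]
    · rw [mul_one]
  have hyi1' : ((y⁻¹ : ideleGroup K) : AdeleRing (𝓞 K) K).1 =
      f₂ ((fun v : S => algebraMap K (v.1.adicCompletion K) a), algebraMap K (InfiniteAdeleRing K) a) :=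
    funext fun w => hyi1 w
  -- `twist y₁` lies in the prescribed neighbourhood of `1`
  have htw : Herbrand.twist c y₁ ∈ H := by
    refine hTe (Herbrand.twist c y₁) ?_ ?_ (fun w => ?_) (fun w hw => ?_)
    · -- archimedean part
      rw [twist_fst, hy₁1, hy₁i1, hy1', hyi1']
      exact ha₁
    · -- archimedean part of the inverse
      rw [twist_inv_fst, hy₁1, hy₁i1, hy1', hyi1']
      exact ha₂
    · -- every finite component of `twist y₁` is a unit
      by_cases hwc : c • w = w
      · exact TorusDict.valuation_eq_one_of_mem_torus c (TorusDict.twist_mem_torus c h2 hc y₁) hwc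
      · rw [twist_snd_apply, map_mul, map_inv₀, valued_galAdicCompletionMap, hy₁2, hy₁2]
        by_cases hwQ : w ∈ Q
        · rw [if_pos (hQinv w hwQ), if_pos hwQ, map_one, map_one, inv_one, mul_one]
        · have hwQ' : c⁻¹ • w ∉ Q := fun h' => hwQ (by
            have := hQsmul _ h'
            rwa [smul_inv_smul] at this)
          have hwB : w ∉ B := fun h' => hwQ (hBQ w h' hwc)
          have hwB' : c⁻¹ • w ∉ B := fun h' => hwQ (hBQ' w (by rwa [inv_smul_place c h2 hc] at h') hwc)
          rw [if_neg hwQ', if_neg hwQ, hunitB _ hwB', hunitB _ hwB, inv_one, mul_one]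
    · -- the congruences at the places named by the neighbourhood
      have hwS : w ∈ S := hT.mem_toFinset.2 hw
      have hwB : w ∈ B := Finset.mem_union_right _ hwS
      by_cases hwc : c • w = w
      · have hwQ : w ∉ Q := fun h' => hQmoved w h' hwc
        rw [twist_snd_apply_of_smul_eq c y₁ hwc, hy₁2, if_neg hwQ, hy2]
        have hlt := ha₄ ⟨w, hwS⟩
        change Valued.v ((z : AdeleRing (𝓞 K) K).2 w * (algebraMap K (w.adicCompletion K) a)⁻¹ - 1) < _ at hlt
        exact valued_gal_mul_inv_sub_one_le c hwc _ (e w) hlt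
      · have hwQ : w ∈ Q := hBQ w hwB hwc
        rw [twist_snd_apply, hy₁2, hy₁2, if_pos (hQinv w hwQ), if_pos hwQ, map_one, inv_one, mul_one, sub_self,
          map_zero]
        exact zero_le
  -- assemble: `χ z = χ (a) · χ y₁ · χ y₂ = χ y₁ ∈ W`
  have hz' : z = GaloisRepresentations.principalIdele K A * (y₁ * y₂) := by
    rw [← hyy, hy, mul_comm (GaloisRepresentations.principalIdele K A) (z * (GaloisRepresentations.principalIdele K A)⁻¹),
      inv_mul_cancel_right]
  rw [hz', map_mul, map_mul, χ.map_principal (GaloisRepresentations.principalIdele_mem A), one_mul, hχy₂, mul_one]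
  exact hkey y₁ htw

/-! ## §2 Two automorphic characters with the same local components at the split places are equal -/

omit [NumberField F₀] in
/-- Automorphic characters of `T(𝔸_{F₀})` are closed under `ψ, ψ′ ↦ ψ · ψ′⁻¹`.
[cite: CasselsFrohlichANT1967, Ch. VII §4] -/
theorem isAutomorphic_mul_inv {ψ ψ' : ↥(TorusDict.torus c) →ₜ* ℂˣ} (hψ : TorusDict.IsAutomorphic c ψ)
    (hψ' : TorusDict.IsAutomorphic c ψ') : TorusDict.IsAutomorphic c (ψ * ψ'⁻¹) := fun t ht => by
  change ψ t * (ψ' t)⁻¹ = 1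
  rw [hψ t ht, hψ' t ht, inv_one, mul_one]

/-- The base change of `ψ · ψ′⁻¹` is the quotient of the base changes (pointwise). [cite: CasselsFrohlichANT1967, Ch. VII §4] -/
theorem pullback_mul_inv_apply {ψ ψ' : ↥(TorusDict.torus c) →ₜ* ℂˣ} (hψ : TorusDict.IsAutomorphic c ψ)
    (hψ' : TorusDict.IsAutomorphic c ψ') (z : ideleGroup K) :
    TorusDict.pullback c h2 hc (ψ * ψ'⁻¹) (isAutomorphic_mul_inv c hψ hψ') z =
      TorusDict.pullback c h2 hc ψ hψ z * (TorusDict.pullback c h2 hc ψ' hψ' z)⁻¹ := rfl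

/-- **RIGIDITY FROM THE SPLIT PLACES (base-change currency).**  Two automorphic characters `ψ, ψ′` of `T(𝔸_{F₀})` whose
base changes `χ̃ = TorusDict.pullback ψ`, `χ̃′` have the same local component `χ̃_w = χ̃′_w` (★
`HeckeCharacter.localComponent`) at every finite place `w` of `K` moved by `c` — the places above the places of `F₀` SPLIT
in `K` — are equal.
[cite: CasselsFrohlichANT1967, Ch. VII §4 Prop. 4.1 (proof); Ch. II §6] [cite: PlatonovRapinchuk1994, §7.3 Prop. 7.8] -/
theorem torusCharacter_eq_of_split (ψ ψ' : ↥(TorusDict.torus c) →ₜ* ℂˣ) (hψ : TorusDict.IsAutomorphic c ψ)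
    (hψ' : TorusDict.IsAutomorphic c ψ')
    (h : ∀ w : HeightOneSpectrum (𝓞 K), c • w ≠ w →
      (TorusDict.pullback c h2 hc ψ hψ).localComponent w = (TorusDict.pullback c h2 hc ψ' hψ').localComponent w) :
    ψ = ψ' := by
  have h1 : ψ * ψ'⁻¹ = 1 := by
    refine torusCharacter_eq_one_of_split c h2 hc (ψ * ψ'⁻¹) (isAutomorphic_mul_inv c hψ hψ') fun w hw a => ?_
    rw [pullback_mul_inv_apply c h2 hc hψ hψ', ← HeckeCharacter.localComponent_apply, ← HeckeCharacter.localComponent_apply, h w hw,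
      mul_inv_cancel]
  exact mul_inv_eq_one.1 h1

end UnitaryGroup

end Literature.NumberTheory.Automorphic

end
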